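import Literature.IUT.HodgeArakelov.ThetaEvaluationModelEvTorsion
import Literature.IUT.HodgeArakelov.ThetaEvaluationModelEvRetractionTop
import Literature.IUT.HodgeArakelov.EtaleThetaDataOfSettingKummerTower
import Literature.IUT.HodgeArakelov.MonoThetaProjectiveBridgeEtTh

/-!
# [IUTchII] Cor. 1.12 (ii) at the model `Π = Π^tp_X̲̲`: the inputs `hfix` and `hcU` (and `hlift`/`hemb`, `hμ`)
# DISCHARGED from the cyclotome tower — proof companion (closing composition of SUBDAG-Cor-112 row Cor-112.ii.r13)

Proof-only companion (abc-iut cell, D-0067 wave 4, seat abc-iut-w4-d007 gen 3; layer L6; node **IUTchII:Cor1.12(ii)**,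
SUBDAG `plan/L6/SUBDAG-IUTchII-Cor-112.md` row Cor-112.ii.r13) to abc-iut-w4-d043's model files
(`ThetaEvaluationModelEvPointed.lean` `cor112_ii_model` p420795, `…RetractionTop.lean` p421351, `…Compact.lean`
p421464), abc-iut-w5-d205's `ThetaEvaluationModelEvTorsion.lean` (`cor112_ii_model_unitGroup` p421726: `hμ` gone at print's
`U = 𝒪^×_{ℚ̄_p}`), abc-iut-w4-d041's `EtaleThetaDataOfSettingCyclotomeTower.lean` (`hfix_of_cyclotomeTower` p419525) and
this seat's `EtaleThetaDataOfSettingKummerTower.lean` (`exists_cyclotomeCoefficients_of_cyclotomeTower` p422741).  No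
definitions; nothing of those files is restated.

S. Mochizuki, *Inter-universal Teichmüller theory II*, kurims manuscript (Dec. 2020), Cor. 1.12 (ii) pp. 56–58
[cite: Mochizuki2012, Cor 1.12 p.56]; *The étale theta function …*, Publ. RIMS **45** (2009), §1 p. 238 "`(Ẑ(1) ≅) Δ_Θ`",
Cor. 2.19 (ii) p. 290 [cite: MochizukiEtTh2009, Cor 2.19 (ii) p.64].  Claim key `Mochizuki2012` (D-0012, DISPUTED); nothing
here takes a side on [IUTchIII] Cor. 3.12.

WHAT IS DISCHARGED.  In `cor112_ii_model_unitGroup` the residual NON-PRINT inputs were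
* `hfix` — «no element `≠ 1` of `l·Δ_Θ` is fixed by `Π^tp_Ÿ̲̲ ∩ K'`» — and
* `hcU : Function.Bijective cU.hom` — the change of coefficient cyclotome `cU : Λ(ℚ̄_pˣ) = Ẑ(1) → l·Δ_Θ` (Cor. 1.11 (a),(b)
  at the model) is an isomorphism — with `cU` itself a free datum,
besides the topological side conditions `hlift`/`hemb` of the retractions (discharged by abc-iut-w4-d043 from
"`D_{μ_-}` compact", `…RetractionTop`).  All of them follow from data the model ALREADY carries: the all-level
cyclotome identifications `mods M : D.CyclotomeMod l M` with their compatibility `hmods` (= abc-iut-L2-t8's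
`CyclotomeTower`, here on abc-iut-w4-d043's chain `EtaleLevels.cyclotomeTower mods hmods`), the origin guard
`IsEtThOrigin` and compactness of `Δ_Θ` (GAP-LEDGER G-w5d187-1):
`hfix` is abc-iut-w4-d041's `hfix_of_cyclotomeTower`; `cU` with `hcU` is this seat's
`exists_cyclotomeCoefficients_of_cyclotomeTower`, pinned down UNIQUELY by `(mods M).red (cU ζ) = ζ_M`
(`eq_of_forall_modAll_red_eq`).

PROVED:
* `EtaleLevels.modAll_cyclotomeTower_red` — the all-level identifications of the chain tower `cyclotomeTower mods hmods`
  ARE the given `mods` (bookkeeping, from `hmods`);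
* **`EtaleLevels.cor112_ii_model_of_cyclotomeTower`** — [IUTchII] Cor. 1.12 (ii) at the model for the MODEL POINTED
  INVERSION, canonical retractions of `ε` (from `D_{μ_-}` compact), constants `ℚ̄_pˣ ⊇ 𝒪^×_{ℚ̄_p}` through `ε`: THERE IS a
  bijective change of coefficient cyclotome `cU` with `(mods M).red (cU ζ) = ζ_M` for all `M` such that `Cor112_ii` holds for
  the model theta-evaluation datum built with it.  Residual NAMED inputs (all print-level or registered): the Rmk. 1.4.1 (ii)
  data of `pointedInversionOfPair` (`α … hstd`), `β`/`hφ`/`hAβ`/`hH`, `hα`/`hβ`, the decomposition-group facts `hDq`,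
  `hDc : IsCompact D_{μ_-}`, `[(D_{μ_-}.map ε).FiniteIndex]`, `[T2Space G_{ℚ_p}]`, the Prop. 2.2 (ii) translate inputs
  `τ`/`hτ`/`hdesc`/`hrev`/`hfree`, and `hO : IsEtThOrigin` (F-2498), `hΔ : IsCompact Δ_Θ` (G-w5d187-1).  GONE: `hfix`, `hcU`
  (and the datum `cU`), `hlift`, `hemb`, `hμ`.
Typed ≠ proved for the residual inputs; instantiated ≠ endorsed.
-/

noncomputable section

namespace Literature.IUT.HodgeArakelov

open Literature.AnabelianGeometry.EtaleTheta Literature.AnabelianGeometry.SemiGraphs CohomologySystemOfContH1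
open Literature.AnabelianGeometry.AbsoluteAnabelian
open scoped Literature.AnabelianGeometry.EtaleTheta

namespace EtaleLevels

variable {p : ℕ} [Fact p.Prime] {D : Literature.AnabelianGeometry.EtaleTheta.ThetaSetting p}
  {E : D.EtaleThetaData} {l : ℕ} (C : E.DoubleUnderline l) (hC : D.Compat) (hS : D.Sec2Hyps)
  (hl : l.Prime) (hp2 : p ≠ 2) (hpl : p ≠ l) (hζ : ∃ ζ : D.K, IsPrimitiveRoot ζ (4 * l))
  (mods : ∀ M : ℕ+, D.CyclotomeMod l M)
  (f : contCocycles D.toTheta D.DeltaTheta C.GtpYdduu) (hf : f ∈ C.rootCocycles hC)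
  (hmods : ∀ (M M' : ℕ+) (h : (M : ℕ) ∣ (M' : ℕ)) (x : D.lDeltaTheta l),
    MuN.red p M M' h ((mods M').red x) = (mods M).red x)
  (h15 : Literature.AnabelianGeometry.EtaleTheta.ThetaSetting.Prop15iii E hC) (L : C.CuspLabels)
  (hZ : ∀ M : ℕ+, Nonempty (ModelCyclotomes.lDeltaQuot (C.rigidData (mods M) hC hS h15 L) ≃*
    Literature.IUT.HodgeTheaters.ZHat))
  (hcharY : EtaleThetaDataOfSetting.PiYddCharacteristic C)
  (hlim : Function.Bijective (rigidLimHom C hC hS hl hp2 hpl hζ mods f hf hmods h15 L hZ))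
  (Env : EnvOfGroup (setting C hC hS hl hp2 hpl hζ mods f hf)
    (modelSystem C hC hS hl hp2 hpl hζ mods f hf hmods h15 L hZ).PiX)

/-! ### The chain tower of the model identifications has the given identifications at every level -/

/-- The all-level identifications `modAll` of abc-iut-w4-d043's chain tower `cyclotomeTower mods hmods` (abc-iut-L2-t8's
`CyclotomeTower` on `chainSet 1 1`) ARE the given `mods M` — by the compatibility `hmods` through the chosen level.
[cite: MochizukiEtTh2009, Cor 2.19 (ii) p.64] -/
theorem modAll_cyclotomeTower_red (M : ℕ+) (x : D.lDeltaTheta l) :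
    ((cyclotomeTower mods hmods (dvd_refl ((1 : ℕ+) : ℕ))).modAll M).red x = (mods M).red x := by
  rw [ThetaSetting.CyclotomeTower.modAll_red, ThetaSetting.CyclotomeTower.redVia_apply]
  exact hmods M _ _ x

/-! ### Cor. 1.12 (ii) at the model, `hfix`/`hcU`/`hlift`/`hemb`/`hμ` discharged -/

section Model

variable
  -- the model pointed inversion (abc-iut-w5-d072's `pointedInversionOfPair`): its named print inputs
  (α : (EtaleThetaDataOfSetting.Pi C) ≃ₜ* (EtaleThetaDataOfSetting.Pi C))
  (hover : ∀ x : EtaleThetaDataOfSetting.Pi C, Env.recon.projG (Env.isoX (α x)) = Env.recon.projG (Env.isoX x))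
  (δ : EtaleThetaDataOfSetting.Pi C) (hδ : Env.recon.projG (Env.isoX δ) = 1)
  (hαα : ∀ x : EtaleThetaDataOfSetting.Pi C, α (α x) = δ * x * δ⁻¹)
  (γ : EtaleThetaDataOfSetting.Pi C) (hγ : C.toLZ γ = Multiplicative.ofAdd 1)
  (hαγ : C.toLZ (α γ) = Multiplicative.ofAdd (-1))
  (huniq : ∀ κ : (EtaleThetaDataOfSetting.Pi C) ≃ₜ* (EtaleThetaDataOfSetting.Pi C),
    (∀ x, Env.recon.projG (Env.isoX (κ x)) = Env.recon.projG (Env.isoX x)) →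
    (∃ δ' : EtaleThetaDataOfSetting.Pi C, Env.recon.projG (Env.isoX δ') = 1 ∧ ∀ x, κ (κ x) = δ' * x * δ'⁻¹) →
    (¬ ∃ δ' : EtaleThetaDataOfSetting.Pi C, Env.recon.projG (Env.isoX δ') = 1 ∧ ∀ x, κ x = δ' * x * δ'⁻¹) →
      ∃ δ' : EtaleThetaDataOfSetting.Pi C, Env.recon.projG (Env.isoX δ') = 1 ∧ ∀ x, κ x = δ' * α x * δ'⁻¹)
  (Dmu : Subgroup (EtaleThetaDataOfSetting.Pi C)) (hDmu : Dmu ≤ EtaleThetaDataOfSetting.PiYdd C)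
  (hfixD : ∃ δ' : ↥(EtaleThetaDataOfSetting.PiYdd C), Env.recon.projG (Env.isoX (δ' : EtaleThetaDataOfSetting.Pi C)) = 1 ∧
    ∀ (d : EtaleThetaDataOfSetting.Pi C) (hd : d ∈ Dmu), ((EtaleThetaDataOfSetting.iotaYddOfAut C hcharY α ⟨d, hDmu hd⟩ :
      EtaleThetaDataOfSetting.PiYdd C) : EtaleThetaDataOfSetting.Pi C) ∈
        Dmu.map (MulAut.conj ((δ' : EtaleThetaDataOfSetting.PiYdd C) : EtaleThetaDataOfSetting.Pi C)).toMonoidHom)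
  (etaStd : (EtaleThetaDataOfSetting.coh C).H1 ⊤) (hmem : etaStd ∈ EtaleThetaDataOfSetting.orbitOne C hC)
  (hstd : (2 * (setting C hC hS hl hp2 hpl hζ mods f hf).l) • EtaleThetaDataOfSetting.resDmuOf C Dmu hDmu etaStd = 0)
  -- the coefficient half of the pair and its printed properties
  (β : D.GtpTheta ≃ₜ* D.GtpTheta)
  (hφ : ∀ g, β (EtaleThetaDataOfSetting.phi C g) = EtaleThetaDataOfSetting.phi C (α g))
  (hAβ : ∀ a : D.GtpTheta, a ∈ D.lDeltaTheta l ↔ β a ∈ D.lDeltaTheta l)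
  (hH : ∀ x, x ∈ EtaleThetaDataOfSetting.PiYdd C ↔ α x ∈ EtaleThetaDataOfSetting.PiYdd C)
  -- decomposition-group facts
  (hDq : ∀ d ∈ Dmu, EtaleThetaDataOfSetting.aug C d = 1 → d = 1)
  (hDc : IsCompact (Dmu : Set (EtaleThetaDataOfSetting.Pi C)))

/-- **[IUTchII] Cor. 1.12 (ii) at the model `Π := Π^tp_X̲̲`, with `hfix`, `hcU` (and the coefficient datum `cU` itself),
`hlift`, `hemb`, `hμ` ALL DISCHARGED.**  For abc-iut-w4-d043's model theta-evaluation datum over the MODEL POINTED INVERSION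
(abc-iut-w5-d072's `pointedInversionOfPair`), the canonical retractions of `ε` (abc-iut-w4-d043's
`LevelRetraction.ofAugmentation` with `hlift`/`hemb` from "`D_{μ_-}` compact", `hlift_of_isCompact`/`hemb_of_isCompact`) and
print's constants `𝒪^×_{ℚ̄_p} ⊆ ℚ̄_pˣ` acted on through `ε`: THERE IS a bijective change of coefficient cyclotome
`cU : Λ(ℚ̄_pˣ) = Ẑ(1) ⥲ l·Δ_Θ` — the one inverse to the model's own identifications, `(mods M).red (cU ζ) = ζ_M` for every `M`
(this seat's `exists_cyclotomeCoefficients_of_cyclotomeTower` on abc-iut-w4-d043's chain tower `cyclotomeTower mods hmods`;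
unique by `eq_of_forall_modAll_red_eq`) — such that the typed `Cor112_ii` (CMR v2, all clauses) HOLDS for the datum built with
it: abc-iut-w5-d205's `cor112_ii_model_unitGroup` with `hfix := hfix_of_cyclotomeTower` (abc-iut-w4-d041) and `hcU` the
bijectivity just constructed.  Residual named inputs: the Rmk. 1.4.1 (ii) data (`α … hstd`), `β`/`hφ`/`hAβ`/`hH`, `hα`/`hβ`,
`hDq`, `hDc`, `[(D_{μ_-}.map ε).FiniteIndex]`, `[T2Space G_{ℚ_p}]`, the Prop. 2.2 (ii) translate inputs
`τ`/`hτ`/`hdesc`/`hrev`/`hfree`, `hO : IsEtThOrigin` (F-2498), `hΔ : IsCompact Δ_Θ` (GAP-LEDGER G-w5d187-1).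
[claim: Mochizuki2012, status: disputed] (IUTchII §1 Cor 1.12 (ii), kurims pp.56-58) -/
theorem cor112_ii_model_of_cyclotomeTower [T2Space (GQp p)] [(Dmu.map (EtaleThetaDataOfSetting.aug C)).FiniteIndex]
    (hO : D.IsEtThOrigin) (hΔ : IsCompact (D.DeltaTheta : Set D.GtpTheta))
    (hα : ∀ x, EtaleThetaDataOfSetting.aug C (α x) = EtaleThetaDataOfSetting.aug C x)
    (hβ : ∀ a : D.GtpTheta, a ∈ D.lDeltaTheta l → β a = a)
    (τ : ℤ → (EtaleThetaDataOfSetting.coh C).H1 ⊤) (hτ : τ 0 = etaStd)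
    (hdesc : ∀ o ∈ EtaleThetaDataOfSetting.orbitOne C hC,
      ∃ (n : ℤ) (c' : (EtaleThetaDataOfSetting.coh C).H1 ⊤), 2 • c' = 0 ∧ o = τ n + c')
    (hrev : ∀ n : ℤ, IsOfFinAddOrder (EtaleThetaDataOfSetting.pairRho C α β hφ hAβ hH (τ n) - τ (-n)))
    (hfree : ∀ m n : ℤ, IsOfFinAddOrder (τ m - τ n) → m = n) :
    ∃ cU : CyclotomeCoefficients (EtaleThetaDataOfSetting.phi C) (D.lDeltaTheta l) (PadicAlgCl p)ˣ,
      Function.Bijective cU.hom ∧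
      (∀ (ζ : Literature.AnabelianGeometry.EtaleTheta.cyclotome (PadicAlgCl p)ˣ) (M : ℕ+),
        (((mods M).red (cU.hom ζ) : MuN p M) : (PadicAlgCl p)ˣ) = (ζ : ℕ+ → (PadicAlgCl p)ˣ) M) ∧
      Literature.IUT.HodgeArakelov.Cor112_ii
        (thetaEvaluation C hC hS hl hp2 hpl hζ mods f hf hmods h15 L hZ hcharY hlim Env
          (EtaleThetaDataOfSetting.pointedInversionOfPair C hC hS hcharY (setting C hC hS hl hp2 hpl hζ mods f hf)
            (ContinuousMulEquiv.refl _) rfl Env α hover δ hδ hαα γ hγ hαγ huniq Dmu hDmu hfixD etaStd hmem hstd)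
          (LevelRetraction.ofAugmentation (EtaleThetaDataOfSetting.phi C) (D.lDeltaTheta l)
            (EtaleThetaDataOfSetting.aug C) Dmu hDq (EtaleThetaDataOfSetting.PiYdd C)
            (EtaleThetaDataOfSetting.continuous_aug C) (aug_ker_acts_trivially C)
            (hlift_of_isCompact (EtaleThetaDataOfSetting.aug C) Dmu (EtaleThetaDataOfSetting.continuous_aug C) hDc)
            (hemb_of_isCompact (EtaleThetaDataOfSetting.aug C) Dmu (EtaleThetaDataOfSetting.continuous_aug C) hDc hDq))
          cU (EtaleThetaDataOfSetting.isOpen_stabilizer_units C) (EtaleThetaDataOfSetting.finiteIndex_stabilizer_units C)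
          (unitGroup ℚ_[p] (PadicAlgCl p)) (EtaleThetaDataOfSetting.pairRhoLim C α β hφ hAβ hH)) := by
  -- the chain tower carrying the model's identifications, and the coefficient iso built from it
  obtain ⟨cU, hcU, hlev⟩ := EtaleThetaDataOfSetting.exists_cyclotomeCoefficients_of_cyclotomeTower C hO hΔ
    (cyclotomeTower mods hmods (dvd_refl ((1 : ℕ+) : ℕ)))
  refine ⟨cU, hcU, fun ζ M => ?_, ?_⟩
  · rw [← modAll_cyclotomeTower_red mods hmods M (cU.hom ζ)]
    exact hlev ζ M
  · exact cor112_ii_model_unitGroup C hC hS hl hp2 hpl hζ mods f hf hmods h15 L hZ hcharY hlim Env α hover δ hδ hαα γ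
      hγ hαγ huniq Dmu hDmu hfixD etaStd hmem hstd β hφ hAβ hH hDq
      (hlift_of_isCompact (EtaleThetaDataOfSetting.aug C) Dmu (EtaleThetaDataOfSetting.continuous_aug C) hDc)
      (hemb_of_isCompact (EtaleThetaDataOfSetting.aug C) Dmu (EtaleThetaDataOfSetting.continuous_aug C) hDc hDq)
      cU hcU hα hβ
      (EtaleThetaDataOfSetting.hfix_of_cyclotomeTower C hO (cyclotomeTower mods hmods (dvd_refl ((1 : ℕ+) : ℕ))))
      τ hτ hdesc hrev hfree

end Model

end EtaleLevels

end Literature.IUT.HodgeArakelov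

end
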